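import Mathlib.Analysis.InnerProductSpace.PiL2
import Mathlib.Tactic.LinearCombination
import HarnessLib

/-!
# Šverák's classification of `(−1)`-homogeneous steady Navier–Stokes flows — the Obata algebra

Analysis/FluidPDE support file of the series `SverakLandau*` proving the named fact
`Literature.Analysis.FluidPDE.Sverak2011_landauClassification` (V. Šverák, J. Math. Sci. 179
(2011) = arXiv:math/0604550, Thm. 1).

The last step of Šverák's proof (§4, after (E4)) classifies the solutions of the Liouville
equation `−Δφ + 2 = 2e^φ` on `S²` by conformal geometry ("the metric `e^φ ḡ` has Gauss curvature
`1` … isometric to `ḡ` … conformal diffeomorphisms of `S²`", [CY], [DFN]).  The series replaces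
this by an **Obata-type integral identity**: for `ψ = e^{−φ/2} > 0` the equation reads
`ψΔψ + ψ² = 1 + |∇ψ|²`, the trace-free Hessian `B = ∇²ψ − ½(Δψ)ḡ` satisfies
`div(ψ⁻¹B(∇ψ)) = ψ⁻¹|B|²`, so `B ≡ 0` after integration, and then `∇(½Δψ + ψ) = div B = 0` and
`∇ψ + (ψ − α)y` is a constant vector `β`: `ψ = α + ⟪β, y⟫`, `α² = 1 + |β|²`.

In the `ℝ³ ∖ {0}` rendering (`Ψ` the `0`-homogeneous extension, `r² = |x|²`, `g = ∇Ψ`,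
`H = ∇²Ψ` with Euler's relations `⟪x, g⟫ = 0`, `Hx = −g`, third derivatives `T` with `T(x,·,·) =
−2H`, the equation `r²(ΨΔΨ − |g|²) + Ψ² = 1` and its gradient) the tensor is
`B̃ = r²H + g xᵀ + x gᵀ − ½r²ΔΨ (I − x xᵀ/r²)` and the field is `Z = Ψ⁻¹B̃g`.  This file is the
**pure finite-sum algebra** (all `∑` over `Fin 3`, no calculus) behind:

* `Sverak2011.obata_div_algebra` — `Ψ² div Z = Ψ |B̃|²/r²` in the expanded form delivered by the
  product rule (`|B̃|²/r² = r²∑H² − 2|g|² − ½r²(ΔΨ)²`);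
* `Sverak2011.obata_normSq_algebra` — `∑ₗₘ B̃ₗₘ² = r⁴∑H² − 2r²|g|² − ½r⁴(ΔΨ)²`;
* `Sverak2011.obata_tangential_algebra` — `⟪x, B̃g⟫ = 0`;
* `Sverak2011.obata_divB_algebra` — `(div B̃)ₘ = ∂ₘ(½r²ΔΨ + Ψ)` in expanded form;
* `Sverak2011.obata_Db_algebra` — the derivative of `b = |x| g + (Ψ − α)x/|x|` is
  `|x|⁻¹(B̃ + (λ − α)(I − xxᵀ/r²))`, `λ = ½r²ΔΨ + Ψ`;
* `Sverak2011.obata_alpha_algebra` — `α² = 1 + |β|²` from the relations at one point.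

## References

* V. Šverák, *On Landau's solutions of the Navier–Stokes equations*, J. Math. Sci. 179 (2011)
  208–228, arXiv:math/0604550, §4, (E4)–(E6). [`Sverak2011`]
* M. Obata, *Certain conditions for a Riemannian manifold to be isometric with a sphere*,
  J. Math. Soc. Japan 14 (1962) 333–340 (the trace-free Hessian argument). [folklore]
-/

noncomputable section

open scoped BigOperators

namespace Literature.Analysis.FluidPDE

namespace Sverak2011

/-- **`Ψ² div Z = Ψ|B̃|²/r²` (Obata identity, bulk form, expanded).**  Symbols at a point:
`x`, `Ψ = P`, `g = ∇Ψ`, `H = ∇²Ψ`, `T = ∇³Ψ` (`T j j m = T m j j`), `L = ΔΨ`, `G = |g|²`,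
`Lj = ∇L`, and the product-rule pieces `br j = r²(Hg)ⱼ + G xⱼ − ½r²L gⱼ` (`= Ψ Zⱼ`),
`dbr j = ∂ⱼ(br j)`.  Under Euler's relations `⟪x, g⟫ = 0`, `Hx = −g` and the gradient of the
equation `r²(ΨL − G) + Ψ² = 1`:
`∑ⱼ (−gⱼ brⱼ + Ψ dbrⱼ) = Ψ (r² ∑H² − 2G − ½r²L²)`. [folklore] -/
theorem obata_div_algebra (x g Lj br dbr : Fin 3 → ℝ) (H : Fin 3 → Fin 3 → ℝ)
    (T : Fin 3 → Fin 3 → Fin 3 → ℝ) (P r2 L G : ℝ)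
    (hr2 : r2 = ∑ i, x i ^ 2) (hL : L = ∑ l, H l l) (hG : G = ∑ l, g l ^ 2)
    (hLj : ∀ j, Lj j = ∑ l, T j l l)
    (hbr : ∀ j, br j = r2 * ∑ m, H j m * g m + G * x j - r2 * L / 2 * g j)
    (hdbr : ∀ j, dbr j = 2 * x j * ∑ m, H j m * g m +
      r2 * ∑ m, (T j j m * g m + H j m * H j m) + (2 * ∑ l, g l * H j l) * x j + G -
      ((x j * L + r2 * Lj j / 2) * g j + r2 * L / 2 * H j j))
    (hE0 : ∑ j, x j * g j = 0) (hE1 : ∀ m, ∑ j, x j * H j m = -g m)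
    (hT : ∀ j m, T j j m = T m j j)
    (hP : ∀ j, 2 * x j * (P * L - G) + r2 * (g j * L + P * Lj j - 2 * ∑ l, g l * H j l) +
      2 * P * g j = 0) :
    ∑ j, (-(g j * br j) + P * dbr j) = P * (r2 * ∑ l, ∑ m, H l m ^ 2 - 2 * G - r2 * L ^ 2 / 2) := by
  simp only [Fin.sum_univ_three] at hr2 hL hG hLj hbr hdbr hE0 hE1 hP ⊢
  simp only [hbr, hdbr, hLj] at hP ⊢
  subst hr2 hL hG
  linear_combination (g 0 / 2) * hP 0 + (g 1 / 2) * hP 1 + (g 2 / 2) * hP 2 +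
    (4 * P * g 0) * hE1 0 + (4 * P * g 1) * hE1 1 + (4 * P * g 2) * hE1 2 +
    (-2 * P * (H 0 0 + H 1 1 + H 2 2)) * hE0 +
    ((x 0 ^ 2 + x 1 ^ 2 + x 2 ^ 2) * P * g 0) * hT 0 0 +
    ((x 0 ^ 2 + x 1 ^ 2 + x 2 ^ 2) * P * g 1) * hT 0 1 +
    ((x 0 ^ 2 + x 1 ^ 2 + x 2 ^ 2) * P * g 2) * hT 0 2 +
    ((x 0 ^ 2 + x 1 ^ 2 + x 2 ^ 2) * P * g 0) * hT 1 0 +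
    ((x 0 ^ 2 + x 1 ^ 2 + x 2 ^ 2) * P * g 1) * hT 1 1 +
    ((x 0 ^ 2 + x 1 ^ 2 + x 2 ^ 2) * P * g 2) * hT 1 2 +
    ((x 0 ^ 2 + x 1 ^ 2 + x 2 ^ 2) * P * g 0) * hT 2 0 +
    ((x 0 ^ 2 + x 1 ^ 2 + x 2 ^ 2) * P * g 1) * hT 2 1 +
    ((x 0 ^ 2 + x 1 ^ 2 + x 2 ^ 2) * P * g 2) * hT 2 2

/-- **`∑ₗₘ B̃ₗₘ² = r⁴∑H² − 2r²|g|² − ½r⁴L²`** for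
`B̃ₗₘ = r²Hₗₘ + gₗxₘ + xₗgₘ − ½r²L δₗₘ + ½L xₗxₘ` under `⟪x, g⟫ = 0`, `Hx = −g`, `H` symmetric.
[folklore] -/
theorem obata_normSq_algebra (x g : Fin 3 → ℝ) (H B : Fin 3 → Fin 3 → ℝ) (r2 L G : ℝ)
    (hr2 : r2 = ∑ i, x i ^ 2) (hL : L = ∑ l, H l l) (hG : G = ∑ l, g l ^ 2)
    (hB : ∀ l m, B l m = r2 * H l m + g l * x m + x l * g m -
      r2 * L / 2 * (if l = m then 1 else 0) + L / 2 * (x l * x m))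
    (hE0 : ∑ j, x j * g j = 0) (hE1 : ∀ m, ∑ j, x j * H j m = -g m)
    (hH : ∀ a b, H a b = H b a) :
    ∑ l, ∑ m, B l m ^ 2 = r2 ^ 2 * ∑ l, ∑ m, H l m ^ 2 - 2 * r2 * G - r2 ^ 2 * L ^ 2 / 2 := by
  simp only [Fin.sum_univ_three] at hr2 hL hG hE0 hE1 ⊢
  simp only [hB]
  simp only [Fin.isValue, if_true, show ((0 : Fin 3) = 1) = False by decide,
    show ((0 : Fin 3) = 2) = False by decide, show ((1 : Fin 3) = 0) = False by decide,
    show ((1 : Fin 3) = 2) = False by decide, show ((2 : Fin 3) = 0) = False by decide,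
    show ((2 : Fin 3) = 1) = False by decide, if_false]
  subst hr2 hL hG
  linear_combination (4 * (x 0 ^ 2 + x 1 ^ 2 + x 2 ^ 2) * g 0) * hE1 0 +
    (4 * (x 0 ^ 2 + x 1 ^ 2 + x 2 ^ 2) * g 1) * hE1 1 +
    (4 * (x 0 ^ 2 + x 1 ^ 2 + x 2 ^ 2) * g 2) * hE1 2 +
    (2 * (x 0 ^ 2 + x 1 ^ 2 + x 2 ^ 2) * g 0 * x 1) * hH 0 1 +
    (2 * (x 0 ^ 2 + x 1 ^ 2 + x 2 ^ 2) * g 0 * x 2) * hH 0 2 +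
    (2 * (x 0 ^ 2 + x 1 ^ 2 + x 2 ^ 2) * g 1 * x 0) * hH 1 0 +
    (2 * (x 0 ^ 2 + x 1 ^ 2 + x 2 ^ 2) * g 1 * x 2) * hH 1 2 +
    (2 * (x 0 ^ 2 + x 1 ^ 2 + x 2 ^ 2) * g 2 * x 0) * hH 2 0 +
    (2 * (x 0 ^ 2 + x 1 ^ 2 + x 2 ^ 2) * g 2 * x 1) * hH 2 1 +
    ((x 0 ^ 2 + x 1 ^ 2 + x 2 ^ 2) * (H 0 0 + H 1 1 + H 2 2) * x 0) * hE1 0 +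
    ((x 0 ^ 2 + x 1 ^ 2 + x 2 ^ 2) * (H 0 0 + H 1 1 + H 2 2) * x 1) * hE1 1 +
    ((x 0 ^ 2 + x 1 ^ 2 + x 2 ^ 2) * (H 0 0 + H 1 1 + H 2 2) * x 2) * hE1 2 +
    (-(x 0 ^ 2 + x 1 ^ 2 + x 2 ^ 2) * (H 0 0 + H 1 1 + H 2 2)) * hE0 +
    (2 * (x 0 * g 0 + x 1 * g 1 + x 2 * g 2)) * hE0

/-- **`⟪x, B̃g⟫ = 0`**: `∑ⱼ xⱼ brⱼ = 0` for `br j = r²(Hg)ⱼ + G xⱼ − ½r²L gⱼ` under `⟪x, g⟫ = 0`,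
`Hx = −g` (the field `Z = Ψ⁻¹B̃g` is tangent to spheres). [folklore] -/
theorem obata_tangential_algebra (x g br : Fin 3 → ℝ) (H : Fin 3 → Fin 3 → ℝ) (r2 L G : ℝ)
    (hr2 : r2 = ∑ i, x i ^ 2) (hG : G = ∑ l, g l ^ 2)
    (hbr : ∀ j, br j = r2 * ∑ m, H j m * g m + G * x j - r2 * L / 2 * g j)
    (hE0 : ∑ j, x j * g j = 0) (hE1 : ∀ m, ∑ j, x j * H j m = -g m) :
    ∑ j, x j * br j = 0 := by
  simp only [Fin.sum_univ_three] at hr2 hG hbr hE0 hE1 ⊢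
  simp only [hbr]
  subst hr2 hG
  linear_combination ((x 0 ^ 2 + x 1 ^ 2 + x 2 ^ 2) * g 0) * hE1 0 +
    ((x 0 ^ 2 + x 1 ^ 2 + x 2 ^ 2) * g 1) * hE1 1 + ((x 0 ^ 2 + x 1 ^ 2 + x 2 ^ 2) * g 2) * hE1 2 +
    (-(x 0 ^ 2 + x 1 ^ 2 + x 2 ^ 2) * L / 2) * hE0

/-- **`div B̃ = ∇(½r²L + Ψ)` (expanded).**  With `dB m = ∑ⱼ ∂ⱼB̃ⱼₘ` written out by the product
rule (`∂ⱼHⱼₘ = Tⱼⱼₘ`, `∂ⱼgₘ = Hⱼₘ`, `∂ⱼL = Ljⱼ = ∑ₗ Tⱼₗₗ`) and collected, Euler's relations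
`Hx = −g`, `T(x,·,·) = −2H` and `Tⱼⱼₘ = Tₘⱼⱼ` give `dB m = gₘ + ½r² Lₘ + L xₘ`. [folklore] -/
theorem obata_divB_algebra (x g Lj dB : Fin 3 → ℝ) (H : Fin 3 → Fin 3 → ℝ)
    (T : Fin 3 → Fin 3 → Fin 3 → ℝ) (r2 L : ℝ)
    (hr2 : r2 = ∑ i, x i ^ 2) (hL : L = ∑ l, H l l) (hLj : ∀ j, Lj j = ∑ l, T j l l)
    (hdB : ∀ m, dB m = ∑ j, (2 * x j * H j m + r2 * T j j m) + (L * x m + g m) +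
      (3 * g m + ∑ j, x j * H j m) - (x m * L + r2 * Lj m / 2) +
      ((∑ j, Lj j * x j) * x m / 2 + 2 * L * x m))
    (hE1 : ∀ m, ∑ j, x j * H j m = -g m) (hE2 : ∀ l m, ∑ j, x j * T j l m = -2 * H l m)
    (hT : ∀ j m, T j j m = T m j j) (m : Fin 3) :
    dB m = g m + r2 / 2 * Lj m + L * x m := by
  simp only [Fin.sum_univ_three] at hr2 hL hLj hdB hE1 hE2 ⊢
  simp only [hdB, hLj]
  subst hr2 hL
  linear_combination 3 * hE1 m + (x 0 ^ 2 + x 1 ^ 2 + x 2 ^ 2) * hT 0 m +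
    (x 0 ^ 2 + x 1 ^ 2 + x 2 ^ 2) * hT 1 m + (x 0 ^ 2 + x 1 ^ 2 + x 2 ^ 2) * hT 2 m +
    (x m / 2) * hE2 0 0 + (x m / 2) * hE2 1 1 + (x m / 2) * hE2 2 2

/-- **The derivative of `b = |x| g + (Ψ − α) x/|x|`** in terms of `B̃`: with `Nr = |x|`,
`W = |x|⁻¹` (`Nr W = 1`, `Nr² = r²`), the product-rule expression
`db j m = xⱼW gₘ + Nr Hⱼₘ + gⱼxₘW + (Ψ − α)(δⱼₘW − xₘxⱼW³)` equals
`W B̃ⱼₘ + (½r²L + Ψ − α)(δⱼₘW − xⱼxₘW³)`. [folklore] -/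
theorem obata_Db_algebra (x g : Fin 3 → ℝ) (H B db : Fin 3 → Fin 3 → ℝ) (r2 L P α Nr W : ℝ)
    (hr2 : r2 = Nr ^ 2) (hNW : Nr * W = 1)
    (hB : ∀ l m, B l m = r2 * H l m + g l * x m + x l * g m -
      r2 * L / 2 * (if l = m then 1 else 0) + L / 2 * (x l * x m))
    (hdb : ∀ j m, db j m = x j * W * g m + Nr * H j m + (g j * x m * W +
      (P - α) * ((if j = m then 1 else 0) * W + x m * (-x j * W ^ 3)))) (j m : Fin 3) :
    db j m = W * B j m + (r2 * L / 2 + P - α) * ((if j = m then 1 else 0) * W - x j * x m * W ^ 3) := by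
  rw [hdb, hB]
  subst hr2
  linear_combination (-H j m * Nr + L / 2 * x j * x m * W * (Nr * W + 1)) * hNW

/-- **`α² = 1 + |β|²` from the relations at one point**: `β = |x| g + (Ψ − α)x/|x|`,
`½r²L + Ψ = α`, the equation `r²(ΨL − |g|²) + Ψ² = 1`, `⟪x, g⟫ = 0`, `|x|² = r²`. [folklore] -/
theorem obata_alpha_algebra (x g β : Fin 3 → ℝ) (r2 L G P α Nr W : ℝ)
    (hX : ∑ i, x i ^ 2 = Nr ^ 2) (hr2 : r2 = Nr ^ 2) (hNW : Nr * W = 1) (hG : G = ∑ l, g l ^ 2)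
    (hβ : ∀ m, β m = Nr * g m + (P - α) * x m * W)
    (hlam : r2 * L / 2 + P = α) (hPDE : r2 * (P * L - G) + P ^ 2 = 1)
    (hE0 : ∑ j, x j * g j = 0) :
    α ^ 2 = 1 + ∑ m, β m ^ 2 := by
  simp only [Fin.sum_univ_three] at hX hG hE0 ⊢
  simp only [hβ]
  subst hr2 hG
  linear_combination hPDE + (-2 * P) * hlam + (-2 * Nr * W * (P - α)) * hE0 +
    (-(P - α) ^ 2 * (Nr * W + 1)) * hNW + (-(P - α) ^ 2 * W ^ 2) * hX

end Sverak2011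

end Literature.Analysis.FluidPDE
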